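import Summits.ResolutionOfSingularities.ResolutionOfSingularities.Theorems.FrobeniusClosingPatchingRelPerfectDepthParamLiftStep
import Summits.ResolutionOfSingularities.ResolutionOfSingularities.Theorems.EquisingularLiftEquisingularLiftNatConePointPresentation
import Literature.AlgebraicGeometry.Resolution.BlowupChartMembership
import Literature.AlgebraicGeometry.Resolution.HypersurfaceTransform
import HarnessLib

/-!
# Crux `PatchingRelPerfect` (stmt-ResolutionOfSingularities-16161), chain W5.2 — F7(β) d = 2 (β-AX), X2a module 2 (M2c), e-chart step E1a:
# the chart index — both exceptional ideals at an e-chart point of the lifted retraction are generated by ONE centre generator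

[OURS · L1 W5.2 · F7(β) (β-AX) X-side · res-D-pv-034 AS res-L1-s36-pv-3 per res-L1-w52-plan-1 RULING G11-21 ((M2c) PARAM
PROPAGATION, e-chart half; blueprint `D/res-D-pv-034/M2C-ECHART-BLUEPRINT.md` step E1a).]  Replaces the role of NO printed item;
NOT a statement of the manuscript under review; fact-free, def-free.  AI-written; AI review is weaker than expert review.

Setting = the binders of res-D-pv-054's `hparam` (`CylState.lift_of`): `τ` blowing up `𝓘(j V(C))`, `τZ` blowing up `C`, `r′ : V′ → Z′`,
`φ : V′ → V` with `φ ≫ ι_V = ι_{V′} ≫ τ`, `r′ ≫ τZ = φ ≫ q`, `r′^* E_{Z′} = E_{X′}|_{V′}`.  For a point `y′ ∈ V′` and generators `a` of the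
stalk of `C` at `q (φ y′)`:

* §1 algebra: `exists_span_singleton_eq_of_span_range_eq` (in a local ring a principal ideal `(g)`, `g` regular, generated by finitely
  many elements is generated by one of them), `isUnit_of_span_singleton_mul_eq`.
* §2 the two stalk squares `stalkMap_square_φ` (`φ^♯ ∘ ι_V^♯ = ι_{V′}^♯ ∘ τ^♯`) and `stalkMap_square_r` (`r′^♯ ∘ τZ^♯ = φ^♯ ∘ q^♯`) at
  `y′`, in the `stalkCongr` currency of the tree's presentation theorem `exists_blowupAlgebra_stalk_ringEquiv_of_stalkIdeal_eq_span_at`.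
* §3 **`CylState.exists_chartIndex`** — there is an index `l` with
  `stalkIdeal (𝓘(jV(C))^* τ) (ι y′) = (τ^♯ (ε⁻¹ σ a_l))` AND `stalkIdeal (C^* τZ) (r′ y′) = (τZ^♯ a_l)`: the e-chart of `y′` for `τ` and of
  `r′ y′` for `τZ` is the SAME centre generator (input of the two stalk presentations, blueprint E1b).

## References
* The Stacks Project, Tag 0804 (affine blowup algebras / charts). [StacksProject]
* U. Görtz, T. Wedhorn, *Algebraic Geometry I* (2020), (13.19). [GortzWedhorn2020]
-/

-- `Summit.<Summit>.<Sub>.Theorems` with `Sub = Summit` (single-conjunct summit, D-0017)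
set_option linter.dupNamespace false

noncomputable section

open CategoryTheory AlgebraicGeometry TopologicalSpace IsLocalRing
open Literature.AlgebraicGeometry.Resolution
open Scheme.IdealSheafData

namespace Summit.ResolutionOfSingularities.ResolutionOfSingularities.Theorems.DepthMultiHost

universe u

/-! ## §1 Algebra -/

section Algebra

variable {R : Type u} [CommRing R]

/-- `(v·w) = (w)` with `w` regular forces `v` to be a unit. [folklore] -/
theorem isUnit_of_span_singleton_mul_eq {v w : R} (hw : w ∈ nonZeroDivisors R) (h : Ideal.span {v * w} = Ideal.span {w}) :
    IsUnit v := by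
  have hmem : w ∈ Ideal.span {v * w} := h ▸ Ideal.mem_span_singleton_self w
  obtain ⟨s, hs⟩ := Ideal.mem_span_singleton'.mp hmem
  have h1 : (s * v - 1) * w = 0 := by rw [sub_mul, one_mul, mul_assoc, hs, sub_self]
  have h2 : s * v - 1 = 0 := (mem_nonZeroDivisors_iff_right.mp hw) _ h1
  exact isUnit_iff_exists_inv'.mpr ⟨s, sub_eq_zero.mp h2⟩

/-- **In a local ring, a principal ideal `(g)` with `g` regular that is generated by finitely many elements `u i` is generated by
one of them.** [folklore] -/
theorem exists_span_singleton_eq_of_span_range_eq [IsLocalRing R] {ι : Type*} [Fintype ι] (u : ι → R) {g : R}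
    (hg : g ∈ nonZeroDivisors R) (h : Ideal.span (Set.range u) = Ideal.span {g}) : ∃ i, Ideal.span {u i} = Ideal.span {g} := by
  classical
  -- `u i = d i * g`
  have hu : ∀ i, ∃ d : R, d * g = u i := fun i =>
    Ideal.mem_span_singleton'.mp (h ▸ Ideal.subset_span (Set.mem_range_self i))
  choose d hd using hu
  -- `g = Σ c i * u i`
  obtain ⟨c, hc⟩ := Ideal.mem_span_range_iff_exists_fun.mp (h.symm ▸ Ideal.mem_span_singleton_self g)
  have h1 : (∑ i, c i * d i - 1) * g = 0 := by
    rw [sub_mul, one_mul, Finset.sum_mul, sub_eq_zero]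
    conv_rhs => rw [← hc]
    exact Finset.sum_congr rfl fun i _ => by rw [mul_assoc, hd]
  have h2 : ∑ i, c i * d i = 1 := sub_eq_zero.mp ((mem_nonZeroDivisors_iff_right.mp hg) _ h1)
  -- some `c i * d i` is a unit
  by_contra hne
  push Not at hne
  have hmem : ∀ i, c i * d i ∈ maximalIdeal R := fun i => by
    rw [mem_maximalIdeal, mem_nonunits_iff]
    intro hunit
    apply hne i
    rw [← hd i]
    exact Ideal.span_singleton_mul_left_unit (isUnit_of_mul_isUnit_right hunit) g
  have : (1 : R) ∈ maximalIdeal R := h2 ▸ Ideal.sum_mem _ fun i _ => hmem i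
  exact (maximalIdeal.isMaximal R).ne_top (Ideal.eq_top_of_isUnit_mem _ this isUnit_one)

end Algebra

/-! ## §2 The stalk squares at a point of the lifted cylinder region -/

namespace CylState

variable {X : Scheme.{u}} {S : MultiHostState X} (cyl : CylState S)

section Squares

variable {X' Z' : Scheme.{u}} {τ : X' ⟶ X} {τZ : Z' ⟶ cyl.Z} {V' : X'.Opens} (r' : (V' : Scheme.{u}) ⟶ Z')
  (φ : (V' : Scheme.{u}) ⟶ (cyl.V : Scheme.{u})) (hφ : φ ≫ cyl.V.ι = V'.ι ≫ τ) (hr'τ : r' ≫ τZ = φ ≫ cyl.q)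
  (y' : (V' : Scheme.{u}))

include hφ in
/-- `τ (ι y′) = ι (φ y′)`. [folklore] -/
theorem τ_ι_eq : τ (V'.ι y') = cyl.V.ι (φ y') := by
  rw [← Scheme.Hom.comp_apply, ← hφ, Scheme.Hom.comp_apply]

include hr'τ in
/-- `τZ (r′ y′) = q (φ y′)`. [folklore] -/
theorem τZ_r_eq : τZ (r' y') = cyl.q (φ y') := by
  rw [← Scheme.Hom.comp_apply, hr'τ, Scheme.Hom.comp_apply]

/-- **The square `φ^♯ ∘ ι_V^♯ = ι_{V′}^♯ ∘ τ^♯`** on `𝒪_{X, ι(φ y′)}` (the stalk of `X` at the named base point of `τ`). [folklore] -/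
theorem stalkMap_square_φ (b : X.presheaf.stalk (cyl.V.ι (φ y'))) :
    (φ.stalkMap y').hom ((cyl.V.ι.stalkMap (φ y')).hom b) =
      (V'.ι.stalkMap y').hom ((τ.stalkMap (V'.ι y')).hom
        ((X.presheaf.stalkCongr (.of_eq (cyl.τ_ι_eq φ hφ y'))).inv.hom b)) := by
  have h1 : (φ ≫ cyl.V.ι).stalkMap y' = cyl.V.ι.stalkMap (φ y') ≫ φ.stalkMap y' := Scheme.Hom.stalkMap_comp _ _ _
  have h2 := Scheme.Hom.stalkMap_congr_hom (φ ≫ cyl.V.ι) (V'.ι ≫ τ) hφ y'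
  have h3 : (V'.ι ≫ τ).stalkMap y' = τ.stalkMap (V'.ι y') ≫ V'.ι.stalkMap y' := Scheme.Hom.stalkMap_comp _ _ _
  rw [h1, h3] at h2
  exact congrArg (fun ψ => ψ.hom b) h2

/-- **The square `r′^♯ ∘ τZ^♯ = φ^♯ ∘ q^♯`** on `𝒪_{Z, q(φ y′)}` (the stalk of `Z` at the named base point of `τZ`). [folklore] -/
theorem stalkMap_square_r (a : cyl.Z.presheaf.stalk (cyl.q (φ y'))) :
    (r'.stalkMap y').hom ((τZ.stalkMap (r' y')).hom
        ((cyl.Z.presheaf.stalkCongr (.of_eq (cyl.τZ_r_eq r' φ hr'τ y'))).inv.hom a)) =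
      (φ.stalkMap y').hom ((cyl.q.stalkMap (φ y')).hom a) := by
  have h1 : (φ ≫ cyl.q).stalkMap y' = cyl.q.stalkMap (φ y') ≫ φ.stalkMap y' := Scheme.Hom.stalkMap_comp _ _ _
  have h2 := Scheme.Hom.stalkMap_congr_hom (φ ≫ cyl.q) (r' ≫ τZ) hr'τ.symm y'
  have h3 : (r' ≫ τZ).stalkMap y' = τZ.stalkMap (r' y') ≫ r'.stalkMap y' := Scheme.Hom.stalkMap_comp _ _ _
  rw [h1, h3] at h2
  exact (congrArg (fun ψ => ψ.hom a) h2).symm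

end Squares

/-! ## §3 The chart index -/

section ChartIndex

variable {X' Z' : Scheme.{u}} (C : cyl.Z.IdealSheafData) {τ : X' ⟶ X} (hτ : IsBlowup τ (vanishingIdeal (cyl.centre C)))
  {τZ : Z' ⟶ cyl.Z} (hτZ : IsBlowup τZ C) {V' : X'.Opens} (r' : (V' : Scheme.{u}) ⟶ Z')
  (φ : (V' : Scheme.{u}) ⟶ (cyl.V : Scheme.{u})) (hφ : φ ≫ cyl.V.ι = V'.ι ≫ τ) (hr'τ : r' ≫ τZ = φ ≫ cyl.q)
  (hexc : (C.comap τZ).comap r' = ((vanishingIdeal (cyl.centre C)).comap τ).comap V'.ι) (y' : (V' : Scheme.{u}))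

include hτ hτZ hexc in
/-- [OURS · L1 W5.2 · F7(β) (β-AX) M2c, E1a] **The chart index.** If `a` generates the stalk of `C` at `q (φ y′)`, then for SOME `l`
both the exceptional ideal of `τ` at `ι y′` and the exceptional ideal of `τZ` at `r′ y′` are generated by (the images of) `a l`:
`y′` lies in the `a l`-chart of `τ` and `r′ y′` in the `a l`-chart of `τZ` — the common input of the two stalk presentations of the
e-chart (blueprint E1b).  From `r′^* E_{Z′} = E_{X′}|_{V′}`: the exceptional stalk at `y′` is generated by the images of the `a l`
and is principal with a regular generator, so one image generates (local ring); pulling back along the local `r′^♯` fixes the chart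
of `r′ y′`. [cite: StacksProject, Tag 0804] -/
theorem exists_chartIndex {c : ℕ} (a : Fin c → cyl.Z.presheaf.stalk (cyl.q (φ y')))
    (ha : Ideal.span (Set.range a) = stalkIdeal C (cyl.q (φ y'))) :
    ∃ l : Fin c,
      stalkIdeal ((vanishingIdeal (cyl.centre C)).comap τ) (V'.ι y') =
          Ideal.span {((X.presheaf.stalkCongr (.of_eq (cyl.τ_ι_eq φ hφ y'))).inv ≫ τ.stalkMap (V'.ι y')).hom
            ((asIso (cyl.V.ι.stalkMap (φ y'))).commRingCatIsoToRingEquiv.symm ((cyl.q.stalkMap (φ y')).hom (a l)))} ∧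
        stalkIdeal (C.comap τZ) (r' y') =
          Ideal.span {((cyl.Z.presheaf.stalkCongr (.of_eq (cyl.τZ_r_eq r' φ hr'τ y'))).inv ≫ τZ.stalkMap (r' y')).hom (a l)} := by
  classical
  -- notation
  set ε : X.presheaf.stalk (cyl.V.ι (φ y')) ≃+* (cyl.V : Scheme.{u}).presheaf.stalk (φ y') :=
    (asIso (cyl.V.ι.stalkMap (φ y'))).commRingCatIsoToRingEquiv with hε
  set ε' : X'.presheaf.stalk (V'.ι y') ≃+* (V' : Scheme.{u}).presheaf.stalk y' :=
    (asIso (V'.ι.stalkMap y')).commRingCatIsoToRingEquiv with hε'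
  set σ : cyl.Z.presheaf.stalk (cyl.q (φ y')) →+* (cyl.V : Scheme.{u}).presheaf.stalk (φ y') :=
    (cyl.q.stalkMap (φ y')).hom with hσ
  set ρ : cyl.Z.presheaf.stalk (cyl.q (φ y')) →+* Z'.presheaf.stalk (r' y') :=
    ((cyl.Z.presheaf.stalkCongr (.of_eq (cyl.τZ_r_eq r' φ hr'τ y'))).inv ≫ τZ.stalkMap (r' y')).hom with hρ
  set θ : X.presheaf.stalk (cyl.V.ι (φ y')) →+* X'.presheaf.stalk (V'.ι y') :=
    ((X.presheaf.stalkCongr (.of_eq (cyl.τ_ι_eq φ hφ y'))).inv ≫ τ.stalkMap (V'.ι y')).hom with hθ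
  set rr : Z'.presheaf.stalk (r' y') →+* (V' : Scheme.{u}).presheaf.stalk y' := (r'.stalkMap y').hom with hrr
  let u : Fin c → (V' : Scheme.{u}).presheaf.stalk y' := fun l => (φ.stalkMap y').hom (σ (a l))
  -- the two squares on generators
  have k1 : ∀ l, rr (ρ (a l)) = u l := fun l => cyl.stalkMap_square_r r' φ hr'τ y' (a l)
  have k2 : ∀ l, ε' (θ (ε.symm (σ (a l)))) = u l := fun l => by
    have h := cyl.stalkMap_square_φ φ hφ y' (ε.symm (σ (a l)))
    have h' : (cyl.V.ι.stalkMap (φ y')).hom (ε.symm (σ (a l))) = σ (a l) := ε.apply_symm_apply (σ (a l))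
    rw [h'] at h
    exact h.symm
  -- the exceptional stalk at `y′`, pushed to `V′`, is generated by the `u l`
  have k3 : (stalkIdeal (C.comap τZ) (r' y')).map rr = Ideal.span (Set.range u) := by
    have hru : Set.range u = rr '' (ρ '' Set.range a) := by
      rw [Set.image_image, ← Set.range_comp]
      exact congrArg Set.range (funext fun l => (k1 l).symm)
    rw [Cruxes.EquisingularLiftNat.Sections.stalkIdeal_comap_eq_map_of_eq τZ C (r' y') (cyl.q (φ y'))
      (cyl.τZ_r_eq r' φ hr'τ y'), ← ha, Ideal.map_span, Ideal.map_span, hru]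
  have k4 : (stalkIdeal ((vanishingIdeal (cyl.centre C)).comap τ) (V'.ι y')).map (ε' : _ →+* _) = Ideal.span (Set.range u) := by
    rw [← k3, hrr, ← stalkIdeal_comap_eq_map_stalkMap r', hexc, stalkIdeal_comap_eq_map_stalkMap V'.ι]
    rfl
  -- a regular generator of the exceptional stalk at `y′`
  obtain ⟨g, hg, hIg⟩ := hτ.isEffectiveCartier.exists_stalkIdeal_eq_span (V'.ι y')
  have hg' : ε' g ∈ nonZeroDivisors _ := by
    refine mem_nonZeroDivisors_iff_right.mpr fun x hx => ?_
    have h1 : ε'.symm x * g = 0 := by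
      apply ε'.injective
      rw [map_mul, ε'.apply_symm_apply, map_zero, hx]
    have h2 := (mem_nonZeroDivisors_iff_right.mp hg) _ h1
    have h3 := congrArg ε' h2
    rwa [ε'.apply_symm_apply, map_zero] at h3
  have hspan : Ideal.span (Set.range u) = Ideal.span {ε' g} := by
    rw [← k4, hIg, Ideal.map_span, Set.image_singleton]; rfl
  obtain ⟨l, hl⟩ := exists_span_singleton_eq_of_span_range_eq u hg' hspan
  refine ⟨l, ?_, ?_⟩
  · -- pull `(u l) = (ε′ g)` back along `ε′`
    have h1 : θ (ε.symm (σ (a l))) = ε'.symm (u l) := by rw [← k2 l, ε'.symm_apply_apply]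
    rw [hIg, h1]
    have h2 : (Ideal.span {u l}).map ε'.symm.toRingHom = (Ideal.span {ε' g}).map ε'.symm.toRingHom := by rw [hl]
    rw [Ideal.map_span, Ideal.map_span, Set.image_singleton, Set.image_singleton] at h2
    have h3 : ε'.symm.toRingHom (ε' g) = g := ε'.symm_apply_apply g
    rw [h3] at h2
    exact h2.symm
  · -- the chart of `r′ y′`: `ρ (a l) = v g′` with `r′^♯ v` a unit, hence `v` a unit
    obtain ⟨g', hg'nzd, hJ⟩ := hτZ.isEffectiveCartier.exists_stalkIdeal_eq_span (r' y')
    have hmem : ρ (a l) ∈ stalkIdeal (C.comap τZ) (r' y') := by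
      rw [Cruxes.EquisingularLiftNat.Sections.stalkIdeal_comap_eq_map_of_eq τZ C (r' y') (cyl.q (φ y')) (cyl.τZ_r_eq r' φ hr'τ y'), ← ha, Ideal.map_span]
      exact Ideal.subset_span ⟨a l, ⟨l, rfl⟩, rfl⟩
    rw [hJ] at hmem
    obtain ⟨v, hv⟩ := Ideal.mem_span_singleton'.mp hmem
    -- `(r′^♯ g′) = (u l)` and `r′^♯ g′` is regular
    have hJ' : Ideal.span {rr g'} = Ideal.span {u l} := by
      have := k3
      rw [hJ, Ideal.map_span, Set.image_singleton] at this
      rw [this, hl, ← hspan]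
    have hrg : rr g' ∈ nonZeroDivisors _ := by
      have h := hJ'.trans (hl.trans rfl)
      exact mem_nonZeroDivisors_of_span_singleton_eq h hg'
    have hunit : IsUnit (rr v) := by
      refine isUnit_of_span_singleton_mul_eq hrg ?_
      rw [← map_mul, hv, k1 l, ← hJ']
    have hv' : IsUnit v := isUnit_of_map_unit rr v hunit
    rw [hJ, ← hv]
    exact (Ideal.span_singleton_mul_left_unit hv' g').symm

end ChartIndex

end CylState

end Summit.ResolutionOfSingularities.ResolutionOfSingularities.Theorems.DepthMultiHost

end
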